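import Mathlib
import HarnessLib
import Summits.HubbardSuperconductivity.HubbardSuperconductivity.Theorems.KLProgrammeH10TwoPointLimitKlAnisoUmklappClass

/-!
# Route `KLProgramme` — K3 engine (stmt-HubbardSuperconductivity-20437), stub (b) (ℓ)/(I2), located item «ON-CLASS-KB» (U):
# THE TARGET SPLITTER — ON the umklapp-active class (reciprocal vector `G₀ ≠ 0`), every admissible fine refinement carries momenta whose
# signed centred representatives sum EXACTLY to `2πG₀`

Cell gate-hubbard-kl, seat p4 g13 (memo HOME/prover-p4/ON-CLASS-KB.md «CLAIM U»).  Twin of p4 g11's splitter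
`sum_signedReps_eq_zero_of_offUmklapp_frame` (`…KlAnisoUmklappClass`): there, for a coarse tuple `σ′` whose signed frame Fermi points at the sector
centres are FAR from every non-zero reciprocal vector, the representatives of any torus-conserving momenta in the supports of a fine refinement `σ″` sum to
`0` in `ℝ²`; here, for a coarse tuple whose signed centre sum is WITHIN `(m+1)·C·w_k` of `2πG₀` (the umklapp-active class keyed by `G₀`), and at
scales with `(m+1)·C·w_k < π`, the representatives sum to `2πG₀` exactly (`sum_signedReps_eq_target_of_onUmklapp_frame`; `C`, `κ`, `k₀` are the
splitter's).  This is the hypothesis under which BGM 2003 Lemma 3.1 WITH A TARGET VECTOR (`Literature/…/FermiRG/BGM2003SectorCountingTarget`,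
`BGM2003.count_target`) applies to the refinements of an umklapp-active coarse tuple.
Everything is PROVED; no definitions, no named facts; nothing here asserts anything about the model or superconductivity.
References: BGM 2006 §2.7 (2.66)–(2.71), §2.8 (2.73), App. A3 [cite: BenfattoGiulianiMastropietro2006].
-/

noncomputable section

namespace Summit.HubbardSuperconductivity.HubbardSuperconductivity.Theorems.PerturbedFermiCurve

set_option linter.dupNamespace false -- summit = problem name (single-conjunct summit), D-0017

open Classical
open Real Set Finset
open Literature.MathematicalPhysics.QuantumLattice Literature.MathematicalPhysics.QuantumLattice.BandSectorCounting
open Literature.Probability.LatticeModels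
open Summit.HubbardSuperconductivity.HubbardSuperconductivity.Theorems.DispersionFlow
open Summit.HubbardSuperconductivity.HubbardSuperconductivity.Theorems.KLRegimeSplit
open Summit.HubbardSuperconductivity.HubbardSuperconductivity.Theorems.KLProgrammeLegKernels
open Summit.HubbardSuperconductivity.HubbardSuperconductivity.Theorems.TorusFourierL2

/-- **THE TARGET SPLITTER (coarse tuples ON the umklapp-active class with reciprocal vector `G₀`).**  For every level window `[μ₁, μ₂] ⊂ (-4, 0)` there
are `κ, C > 0` and a scale `k₀` (those of `sum_signedReps_eq_zero_of_offUmklapp_frame`) such that for every frame `K` with `4A ≤ κ`, `μ ∈ [μ₁, μ₂]`,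
scales `k₀ ≤ k ≤ J′` with `(m+1)·C·w_k < π`, every coarse tuple `σ′` whose signed frame Fermi points at the sector centres sum to within `(m+1)·C·w_k` of
`2πG₀` in every coordinate, every fine tuple `σ″` refining it leg by leg, and every choice of momenta in the supports of `σ″` conserving momentum on the
torus: the signed centred representatives sum to `2πG₀`. [cite: BenfattoGiulianiMastropietro2006, §2.7 (2.66)-(2.71), §2.8 (2.73), App. A3] -/
theorem sum_signedReps_eq_target_of_onUmklapp_frame :
    ∀ μ₁ μ₂ : ℝ, -4 < μ₁ → μ₁ ≤ μ₂ → μ₂ < 0 → ∃ κ : ℝ, 0 < κ ∧ ∃ C : ℝ, 0 < C ∧ ∃ k₀ : ℕ,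
      ∀ (K : TrigPolyC4v) (A : ℝ), (∀ p : Momentum, ∀ j ≤ 2, ‖iteratedFDeriv ℝ j (frameShift K) p‖ ≤ A) → 4 * A ≤ κ →
      ∀ μ ∈ Set.Icc μ₁ μ₂, ∀ (L M : ℕ) [NeZero L] (β : ℝ) (m k J' : ℕ), k₀ ≤ k → k ≤ J' →
      ∀ (σ' : Fin (m + 1) → SectorLeg (sectorCount k)) (σ'' : Fin (m + 1) → SectorLeg (sectorCount J')),
      (∀ i, (∃ q : FreqMomentum L M, klAnisoFamily L M β μ K klE0 J' (σ'' i).1.1 q ≠ 0 ∧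
          bgmFatMultiplier L M klE0 β (nambuXiCT L μ K) k (σ' i).1.1 q ≠ 0) ∧ (σ' i).1.2 = (σ'' i).1.2 ∧ (σ' i).2 = (σ'' i).2) →
      ∀ G₀ : Fin 2 → ℤ,
      (∀ j : Fin 2, |∑ i, (if (σ' i).2 = 0 then klFermiPoint μ K (sectorCenter k (σ' i).1.1) j
              else -klFermiPoint μ K (sectorCenter k (σ' i).1.1) j) - 2 * π * (G₀ j : ℝ)| ≤ ((m : ℝ) + 1) * C * sectorWidth k) →
      ((m : ℝ) + 1) * C * sectorWidth k < π →
      ∀ kf : Fin (m + 1) → FreqMomentum L M, (∀ i, klAnisoFamily L M β μ K klE0 J' (σ'' i).1.1 (kf i) ≠ 0) →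
        ∑ i, signedMomentum L (σ'' i).2 (kf i).2 = 0 →
        ∀ j : Fin 2, ∑ i, (if (σ'' i).2 = 0 then torusCentredMomentum L (kf i).2 j else -torusCentredMomentum L (kf i).2 j) =
          2 * π * (G₀ j : ℝ) := by
  intro μ₁ μ₂ hμ₁ h12 hμ₂
  have ha : -4 < (μ₁ - 4) / 2 := by linarith
  have hab : (μ₁ - 4) / 2 ≤ μ₂ / 2 := by linarith
  have hb : μ₂ / 2 < 0 := by linarith
  obtain ⟨B, -⟩ : ∃ B : BandBounds ((μ₁ - 4) / 2) (μ₂ / 2), B = bandBounds ha hab hb := ⟨_, rfl⟩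
  obtain ⟨m₀, hm₀def⟩ : ∃ m₀ : ℝ, m₀ = min (μ₁ - (μ₁ - 4) / 2) (μ₂ / 2 - μ₂) := ⟨_, rfl⟩
  have hm₀ : 0 < m₀ := by rw [hm₀def]; exact lt_min (by linarith) (by linarith)
  have hm1 : m₀ ≤ μ₁ - (μ₁ - 4) / 2 := by rw [hm₀def]; exact min_le_left _ _
  have hm2 : m₀ ≤ μ₂ / 2 - μ₂ := by rw [hm₀def]; exact min_le_right _ _
  have hDt := B.Dtmin_pos; have hs := B.smax_pos; have hπ := Real.pi_pos
  have he : (0 : ℝ) < klE0 := by norm_num [klE0]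
  -- the scale threshold: `Λ_{k₀} ≤ m₀/2`
  obtain ⟨k₀, hk₀⟩ : ∃ k₀ : ℕ, klScale klE0 k₀ ≤ m₀ / 2 := by
    obtain ⟨k₀, hk₀⟩ := exists_pow_lt_of_lt_one (show 0 < m₀ / 2 / klE0 by positivity) (show (4 : ℝ)⁻¹ < 1 by norm_num)
    refine ⟨k₀, ?_⟩
    unfold klScale
    rw [← inv_pow]
    have := (lt_div_iff₀ he).1 hk₀
    linarith [mul_comm ((4 : ℝ)⁻¹ ^ k₀) klE0]
  obtain ⟨C, hC⟩ : ∃ C : ℝ, C = 2 * (klE0 / π + B.smax * B.Dtmin * (13 / 4)) / B.Dtmin := ⟨_, rfl⟩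
  have hC0 : 0 < C := by rw [hC]; positivity
  refine ⟨min (B.Dtmin / 2) (m₀ / 2), lt_min (by positivity) (by positivity), C, hC0, k₀, ?_⟩
  intro K A hA hAκ μ hμ L M _ β m k J' hk₀k hkJ σ' σ'' hover G₀ hon hsmall kf hkF hsum j
  have hA0 : 0 ≤ A := le_trans (norm_nonneg _) (hA 0 0 (by norm_num))
  have hκD : 4 * A ≤ B.Dtmin / 2 := hAκ.trans (min_le_left _ _)
  have hκm : 4 * A ≤ m₀ / 2 := hAκ.trans (min_le_right _ _)
  have hA2 : 2 * A < B.Dtmin := by linarith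
  have hΛ : klScale klE0 k ≤ m₀ / 2 := (klld_klScale_anti hk₀k).trans hk₀
  have hlo : (μ₁ - 4) / 2 ≤ μ - A - klScale klE0 k := by linarith [hμ.1]
  have hhi : μ + A + klScale klE0 k ≤ μ₂ / 2 := by linarith [hμ.2]
  have hwk : 0 < sectorWidth k := sectorWidth_pos k
  have hwπ : sectorWidth k ≤ π := sectorWidth_le_pi k
  -- the cell radius at the coarse centre is `≤ C·w_k`
  have hden : B.Dtmin / 2 ≤ B.Dtmin - 2 * A := by linarith
  have hrad : (klScale klE0 k + B.smax * B.Dtmin * (13 / 4 * sectorWidth k)) / (B.Dtmin - 2 * A) ≤ C * sectorWidth k := by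
    have hkl : klScale klE0 k ≤ klE0 / π * sectorWidth k := by
      rw [klScale_eq_mul_sectorWidth_sq, div_mul_eq_mul_div, div_mul_eq_mul_div, div_le_div_iff₀ (by positivity) (by positivity)]
      calc klE0 * sectorWidth k ^ 2 * π = (klE0 * sectorWidth k * π) * sectorWidth k := by ring
        _ ≤ (klE0 * sectorWidth k * π) * π := mul_le_mul_of_nonneg_left hwπ (by positivity)
        _ = klE0 * sectorWidth k * π ^ 2 := by ring
    have hnum : klScale klE0 k + B.smax * B.Dtmin * (13 / 4 * sectorWidth k) ≤ (klE0 / π + B.smax * B.Dtmin * (13 / 4)) * sectorWidth k := by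
      rw [add_mul]; linarith
    have h1 : (klScale klE0 k + B.smax * B.Dtmin * (13 / 4 * sectorWidth k)) / (B.Dtmin - 2 * A) ≤
        (klE0 / π + B.smax * B.Dtmin * (13 / 4)) * sectorWidth k / (B.Dtmin / 2) :=
      div_le_div₀ (by positivity) hnum (by positivity) hden
    have e : (klE0 / π + B.smax * B.Dtmin * (13 / 4)) * sectorWidth k / (B.Dtmin / 2) = C * sectorWidth k := by
      rw [hC, div_eq_iff (by positivity)]
      field_simp
    linarith [h1, e]
  -- the reciprocal vector IS `G₀`
  obtain ⟨G, hG⟩ := exists_sum_signed_torusCentredMomentum_eq L (fun i => (σ'' i).2) (fun i => (kf i).2) hsum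
  -- every coordinate of `2π(G − G₀)` is `< 2π` in modulus
  have hcoord : ∀ j' : Fin 2, |2 * π * ((G j' : ℝ) - (G₀ j' : ℝ))| < 2 * π := by
    intro j'
    have hclose : |∑ i, (if (σ'' i).2 = 0 then torusCentredMomentum L (kf i).2 j' else -torusCentredMomentum L (kf i).2 j') -
        ∑ i, (if (σ' i).2 = 0 then klFermiPoint μ K (sectorCenter k (σ' i).1.1) j'
          else -klFermiPoint μ K (sectorCenter k (σ' i).1.1) j')| ≤ ((m : ℝ) + 1) * C * sectorWidth k := by
      rw [← Finset.sum_sub_distrib]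
      refine (Finset.abs_sum_le_sum_abs _ _).trans ?_
      have hleg' : ∀ i, |(if (σ'' i).2 = 0 then torusCentredMomentum L (kf i).2 j' else -torusCentredMomentum L (kf i).2 j') -
          (if (σ' i).2 = 0 then klFermiPoint μ K (sectorCenter k (σ' i).1.1) j'
          else -klFermiPoint μ K (sectorCenter k (σ' i).1.1) j')| ≤ C * sectorWidth k := by
        intro i
        obtain ⟨⟨q₀, hq₀, hq₀'⟩, -, hc⟩ := hover i
        have h := (abs_rep_sub_fermiPoint_le_of_overlap B hA hA2 L M hkJ hlo hhi (hkF i) hq₀ hq₀' j').trans hrad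
        rw [← hc]
        split_ifs
        · exact h
        · have e : -torusCentredMomentum L (kf i).2 j' - -klFermiPoint μ K (sectorCenter k (σ' i).1.1) j' =
              -(torusCentredMomentum L (kf i).2 j' - klFermiPoint μ K (sectorCenter k (σ' i).1.1) j') := by ring
          rw [e, abs_neg]; exact h
      calc ∑ i, |(if (σ'' i).2 = 0 then torusCentredMomentum L (kf i).2 j' else -torusCentredMomentum L (kf i).2 j') -
            (if (σ' i).2 = 0 then klFermiPoint μ K (sectorCenter k (σ' i).1.1) j'
            else -klFermiPoint μ K (sectorCenter k (σ' i).1.1) j')|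
          ≤ ∑ _i : Fin (m + 1), C * sectorWidth k := Finset.sum_le_sum fun i _ => hleg' i
        _ = ((m : ℝ) + 1) * C * sectorWidth k := by simp; ring
    have h1 : |2 * π * (G j' : ℝ) - 2 * π * (G₀ j' : ℝ)| ≤ 2 * (((m : ℝ) + 1) * C * sectorWidth k) := by
      rw [← hG j']
      have := abs_sub_le (∑ i, (if (σ'' i).2 = 0 then torusCentredMomentum L (kf i).2 j' else -torusCentredMomentum L (kf i).2 j'))
        (∑ i, (if (σ' i).2 = 0 then klFermiPoint μ K (sectorCenter k (σ' i).1.1) j'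
          else -klFermiPoint μ K (sectorCenter k (σ' i).1.1) j')) (2 * π * (G₀ j' : ℝ))
      linarith [hon j']
    rw [← mul_sub] at h1
    linarith
  -- hence `G = G₀` coordinatewise (integers)
  have hGG : G j = G₀ j := by
    by_contra hne
    have hint : (1 : ℝ) ≤ |(G j : ℝ) - (G₀ j : ℝ)| := by
      rw [← Int.cast_sub, ← Int.cast_abs]
      exact_mod_cast Int.one_le_abs (sub_ne_zero.2 hne)
    have h2 : 2 * π ≤ |2 * π * ((G j : ℝ) - (G₀ j : ℝ))| := by
      rw [abs_mul, abs_of_pos (by positivity)]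
      nlinarith
    linarith [hcoord j]
  rw [hG j, hGG]

/-- **THE TARGET SPLITTER AT AN ARBITRARY TOLERANCE.**  As `sum_signedReps_eq_target_of_onUmklapp_frame` (same `κ, C, k₀`), but the coarse tuple is
assumed on the class of `G₀` with an ARBITRARY tolerance constant `C′` (`|Σ ± k_F − 2πG₀|_∞ ≤ (m+1)·C′·w_k`) and the scale condition reads
`(m+1)(C + C′)·w_k < 2π`; the conclusion is the same (the fine representatives sum to `2πG₀`).  With `C′ := C_off` of the off-class row this makes the
on-class rows consumable on the complement of the off-class hypothesis (cell memo CLAIM-U-API §3c).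
[cite: BenfattoGiulianiMastropietro2006, §2.7 (2.66)-(2.71), §2.8 (2.73), App. A3] -/
theorem sum_signedReps_eq_target_of_onUmklapp_frame_tol :
    ∀ μ₁ μ₂ : ℝ, -4 < μ₁ → μ₁ ≤ μ₂ → μ₂ < 0 → ∃ κ : ℝ, 0 < κ ∧ ∃ C : ℝ, 0 < C ∧ ∃ k₀ : ℕ,
      ∀ (K : TrigPolyC4v) (A : ℝ), (∀ p : Momentum, ∀ j ≤ 2, ‖iteratedFDeriv ℝ j (frameShift K) p‖ ≤ A) → 4 * A ≤ κ →
      ∀ μ ∈ Set.Icc μ₁ μ₂, ∀ (L M : ℕ) [NeZero L] (β : ℝ) (m k J' : ℕ), k₀ ≤ k → k ≤ J' →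
      ∀ (σ' : Fin (m + 1) → SectorLeg (sectorCount k)) (σ'' : Fin (m + 1) → SectorLeg (sectorCount J')),
      (∀ i, (∃ q : FreqMomentum L M, klAnisoFamily L M β μ K klE0 J' (σ'' i).1.1 q ≠ 0 ∧
          bgmFatMultiplier L M klE0 β (nambuXiCT L μ K) k (σ' i).1.1 q ≠ 0) ∧ (σ' i).1.2 = (σ'' i).1.2 ∧ (σ' i).2 = (σ'' i).2) →
      ∀ (G₀ : Fin 2 → ℤ) (C' : ℝ),
      (∀ j : Fin 2, |∑ i, (if (σ' i).2 = 0 then klFermiPoint μ K (sectorCenter k (σ' i).1.1) j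
              else -klFermiPoint μ K (sectorCenter k (σ' i).1.1) j) - 2 * π * (G₀ j : ℝ)| ≤ ((m : ℝ) + 1) * C' * sectorWidth k) →
      ((m : ℝ) + 1) * (C + C') * sectorWidth k < 2 * π →
      ∀ kf : Fin (m + 1) → FreqMomentum L M, (∀ i, klAnisoFamily L M β μ K klE0 J' (σ'' i).1.1 (kf i) ≠ 0) →
        ∑ i, signedMomentum L (σ'' i).2 (kf i).2 = 0 →
        ∀ j : Fin 2, ∑ i, (if (σ'' i).2 = 0 then torusCentredMomentum L (kf i).2 j else -torusCentredMomentum L (kf i).2 j) =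
          2 * π * (G₀ j : ℝ) := by
  intro μ₁ μ₂ hμ₁ h12 hμ₂
  have ha : -4 < (μ₁ - 4) / 2 := by linarith
  have hab : (μ₁ - 4) / 2 ≤ μ₂ / 2 := by linarith
  have hb : μ₂ / 2 < 0 := by linarith
  obtain ⟨B, -⟩ : ∃ B : BandBounds ((μ₁ - 4) / 2) (μ₂ / 2), B = bandBounds ha hab hb := ⟨_, rfl⟩
  obtain ⟨m₀, hm₀def⟩ : ∃ m₀ : ℝ, m₀ = min (μ₁ - (μ₁ - 4) / 2) (μ₂ / 2 - μ₂) := ⟨_, rfl⟩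
  have hm₀ : 0 < m₀ := by rw [hm₀def]; exact lt_min (by linarith) (by linarith)
  have hm1 : m₀ ≤ μ₁ - (μ₁ - 4) / 2 := by rw [hm₀def]; exact min_le_left _ _
  have hm2 : m₀ ≤ μ₂ / 2 - μ₂ := by rw [hm₀def]; exact min_le_right _ _
  have hDt := B.Dtmin_pos; have hs := B.smax_pos; have hπ := Real.pi_pos
  have he : (0 : ℝ) < klE0 := by norm_num [klE0]
  -- the scale threshold: `Λ_{k₀} ≤ m₀/2`
  obtain ⟨k₀, hk₀⟩ : ∃ k₀ : ℕ, klScale klE0 k₀ ≤ m₀ / 2 := by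
    obtain ⟨k₀, hk₀⟩ := exists_pow_lt_of_lt_one (show 0 < m₀ / 2 / klE0 by positivity) (show (4 : ℝ)⁻¹ < 1 by norm_num)
    refine ⟨k₀, ?_⟩
    unfold klScale
    rw [← inv_pow]
    have := (lt_div_iff₀ he).1 hk₀
    linarith [mul_comm ((4 : ℝ)⁻¹ ^ k₀) klE0]
  obtain ⟨C, hC⟩ : ∃ C : ℝ, C = 2 * (klE0 / π + B.smax * B.Dtmin * (13 / 4)) / B.Dtmin := ⟨_, rfl⟩
  have hC0 : 0 < C := by rw [hC]; positivity
  refine ⟨min (B.Dtmin / 2) (m₀ / 2), lt_min (by positivity) (by positivity), C, hC0, k₀, ?_⟩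
  intro K A hA hAκ μ hμ L M _ β m k J' hk₀k hkJ σ' σ'' hover G₀ C' hon hsmall kf hkF hsum j
  have hA0 : 0 ≤ A := le_trans (norm_nonneg _) (hA 0 0 (by norm_num))
  have hκD : 4 * A ≤ B.Dtmin / 2 := hAκ.trans (min_le_left _ _)
  have hκm : 4 * A ≤ m₀ / 2 := hAκ.trans (min_le_right _ _)
  have hA2 : 2 * A < B.Dtmin := by linarith
  have hΛ : klScale klE0 k ≤ m₀ / 2 := (klld_klScale_anti hk₀k).trans hk₀
  have hlo : (μ₁ - 4) / 2 ≤ μ - A - klScale klE0 k := by linarith [hμ.1]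
  have hhi : μ + A + klScale klE0 k ≤ μ₂ / 2 := by linarith [hμ.2]
  have hwk : 0 < sectorWidth k := sectorWidth_pos k
  have hwπ : sectorWidth k ≤ π := sectorWidth_le_pi k
  -- the cell radius at the coarse centre is `≤ C·w_k`
  have hden : B.Dtmin / 2 ≤ B.Dtmin - 2 * A := by linarith
  have hrad : (klScale klE0 k + B.smax * B.Dtmin * (13 / 4 * sectorWidth k)) / (B.Dtmin - 2 * A) ≤ C * sectorWidth k := by
    have hkl : klScale klE0 k ≤ klE0 / π * sectorWidth k := by
      rw [klScale_eq_mul_sectorWidth_sq, div_mul_eq_mul_div, div_mul_eq_mul_div, div_le_div_iff₀ (by positivity) (by positivity)]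
      calc klE0 * sectorWidth k ^ 2 * π = (klE0 * sectorWidth k * π) * sectorWidth k := by ring
        _ ≤ (klE0 * sectorWidth k * π) * π := mul_le_mul_of_nonneg_left hwπ (by positivity)
        _ = klE0 * sectorWidth k * π ^ 2 := by ring
    have hnum : klScale klE0 k + B.smax * B.Dtmin * (13 / 4 * sectorWidth k) ≤ (klE0 / π + B.smax * B.Dtmin * (13 / 4)) * sectorWidth k := by
      rw [add_mul]; linarith
    have h1 : (klScale klE0 k + B.smax * B.Dtmin * (13 / 4 * sectorWidth k)) / (B.Dtmin - 2 * A) ≤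
        (klE0 / π + B.smax * B.Dtmin * (13 / 4)) * sectorWidth k / (B.Dtmin / 2) :=
      div_le_div₀ (by positivity) hnum (by positivity) hden
    have e : (klE0 / π + B.smax * B.Dtmin * (13 / 4)) * sectorWidth k / (B.Dtmin / 2) = C * sectorWidth k := by
      rw [hC, div_eq_iff (by positivity)]
      field_simp
    linarith [h1, e]
  -- the reciprocal vector IS `G₀`
  obtain ⟨G, hG⟩ := exists_sum_signed_torusCentredMomentum_eq L (fun i => (σ'' i).2) (fun i => (kf i).2) hsum
  -- every coordinate of `2π(G − G₀)` is `< 2π` in modulus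
  have hcoord : ∀ j' : Fin 2, |2 * π * ((G j' : ℝ) - (G₀ j' : ℝ))| < 2 * π := by
    intro j'
    have hclose : |∑ i, (if (σ'' i).2 = 0 then torusCentredMomentum L (kf i).2 j' else -torusCentredMomentum L (kf i).2 j') -
        ∑ i, (if (σ' i).2 = 0 then klFermiPoint μ K (sectorCenter k (σ' i).1.1) j'
          else -klFermiPoint μ K (sectorCenter k (σ' i).1.1) j')| ≤ ((m : ℝ) + 1) * C * sectorWidth k := by
      rw [← Finset.sum_sub_distrib]
      refine (Finset.abs_sum_le_sum_abs _ _).trans ?_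
      have hleg' : ∀ i, |(if (σ'' i).2 = 0 then torusCentredMomentum L (kf i).2 j' else -torusCentredMomentum L (kf i).2 j') -
          (if (σ' i).2 = 0 then klFermiPoint μ K (sectorCenter k (σ' i).1.1) j'
          else -klFermiPoint μ K (sectorCenter k (σ' i).1.1) j')| ≤ C * sectorWidth k := by
        intro i
        obtain ⟨⟨q₀, hq₀, hq₀'⟩, -, hc⟩ := hover i
        have h := (abs_rep_sub_fermiPoint_le_of_overlap B hA hA2 L M hkJ hlo hhi (hkF i) hq₀ hq₀' j').trans hrad
        rw [← hc]
        split_ifs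
        · exact h
        · have e : -torusCentredMomentum L (kf i).2 j' - -klFermiPoint μ K (sectorCenter k (σ' i).1.1) j' =
              -(torusCentredMomentum L (kf i).2 j' - klFermiPoint μ K (sectorCenter k (σ' i).1.1) j') := by ring
          rw [e, abs_neg]; exact h
      calc ∑ i, |(if (σ'' i).2 = 0 then torusCentredMomentum L (kf i).2 j' else -torusCentredMomentum L (kf i).2 j') -
            (if (σ' i).2 = 0 then klFermiPoint μ K (sectorCenter k (σ' i).1.1) j'
            else -klFermiPoint μ K (sectorCenter k (σ' i).1.1) j')|
          ≤ ∑ _i : Fin (m + 1), C * sectorWidth k := Finset.sum_le_sum fun i _ => hleg' i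
        _ = ((m : ℝ) + 1) * C * sectorWidth k := by simp; ring
    have h1 : |2 * π * (G j' : ℝ) - 2 * π * (G₀ j' : ℝ)| ≤ ((m : ℝ) + 1) * C * sectorWidth k + ((m : ℝ) + 1) * C' * sectorWidth k := by
      rw [← hG j']
      have := abs_sub_le (∑ i, (if (σ'' i).2 = 0 then torusCentredMomentum L (kf i).2 j' else -torusCentredMomentum L (kf i).2 j'))
        (∑ i, (if (σ' i).2 = 0 then klFermiPoint μ K (sectorCenter k (σ' i).1.1) j'
          else -klFermiPoint μ K (sectorCenter k (σ' i).1.1) j')) (2 * π * (G₀ j' : ℝ))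
      linarith [hon j']
    rw [← mul_sub] at h1
    have e : ((m : ℝ) + 1) * (C + C') * sectorWidth k = ((m : ℝ) + 1) * C * sectorWidth k + ((m : ℝ) + 1) * C' * sectorWidth k := by ring
    linarith
  -- hence `G = G₀` coordinatewise (integers)
  have hGG : G j = G₀ j := by
    by_contra hne
    have hint : (1 : ℝ) ≤ |(G j : ℝ) - (G₀ j : ℝ)| := by
      rw [← Int.cast_sub, ← Int.cast_abs]
      exact_mod_cast Int.one_le_abs (sub_ne_zero.2 hne)
    have h2 : 2 * π ≤ |2 * π * ((G j : ℝ) - (G₀ j : ℝ))| := by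
      rw [abs_mul, abs_of_pos (by positivity)]
      nlinarith
    linarith [hcoord j]
  rw [hG j, hGG]

end Summit.HubbardSuperconductivity.HubbardSuperconductivity.Theorems.PerturbedFermiCurve

end
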